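import Mathlib
import Summits.QuantumFields.BalabanUV.Beta.FP.PerfectFFBlockTorus
import Summits.QuantumFields.BalabanUV.Beta.FP.CompositeCovarianceJunction
import Summits.QuantumFields.BalabanUV.Beta.FP.PeriodisationBound
import Summits.QuantumFields.BalabanUV.Beta.FP.SliceLegRemainderBounded
import Summits.QuantumFields.BalabanUV.Beta.GAN24.RealRateKMHolds

/-!
# Road «FP», row IR-5′ (c′) — FILE F5b: **THE PERFECT ff BLOCK IS BOUNDED UNIFORMLY IN (j, m)** — the m-UNIFORM SUP LETTER
# `|unitK (Mb) · (KTot (n·Mb) Mb) · ff| ≤ CffSup d`, `|KPerf … m ff| ≤ CffSup 3`, `Bdd (blk (KPerf m) tt) (CffSup 3)`, NO `Prop12Printed`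

Cell `pub-balaban`, β sub-cell, binder row D1, road «FP» (owner `b2b-balaban-beta-d1-p3`, «GO» journal 2026-08-21T10:09Z;
statement-first post 10:27Z), lane (U2) IR-5′ (unit `b2b-balaban-beta-d1-formalise-leaf-05`, gen 17).  Last module of the chain
`FF-SUP-PLAN.md` (W): F1 `CovarianceLoewnerSandwich` · F2 `TorusLaplaceComparison` · F3 `TorusSupersolution(Algebra)` · F4
`BlockMeanVariance` · F5a `PerfectFFBlockTorus` · THIS FILE.

## What this file certifies (kernel; [our object] = about an2's typed `U = 1` step system on `ℤ^{d+1}`)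
* §1 `unitK_KTot_inl_inl` — the ff block of the unit-rescaled (j,m)-resolvent is the block-contour double sum
  `sf·(Σ_{i,i'∈LegIdx} legW·legW·Gam κ p_i l q_{i'})·sf` (`unitK_apply`, `KTot_def`, `dec`, `KInv_inl_inl` — definitional);
  `l1_le_l1_pshift`, `summable_Gam_pshift`, `summable_Gam_leg`, `summable_unitK_KTot_ff` (from `OneStepResolventKernel.decays_KInv`).
* §2 THE JUNCTION AT INTEGER POINTS: `tsum_Gam_pshift_eq_re_Cov` — `Σ_t Gam κ p l (q + (N·M)•t) = (N²∕2)·Re 𝒞_{(p̄,κ),(q̄,l)}`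
  (g15 `CompositeCovarianceJunction.tsum_Gam_pshift_eq_Cov` + periodicity + `Periodic.apply_liftT_toTor`; `𝒞` is real).
* §3 `tsum_unitK_KTot_ff_pshift_eq` — the coarse periodisation (periods `n·M_ν`, `N = n·Mb`) of the ff block is
  `(Mb²N²∕2)·Σ_{i,i'} legW·legW·Re 𝒞(p̄_i, q̄_{i'})`; with F5a: `abs_tsum_unitK_KTot_ff_pshift_le` — `≤ CffSup d` on every large torus,
  **`CffSup d := (gammaZero (d+1) 1)⁻¹ · (d+3)^5 ∕ 8`** (`Mb²(2Mb+d+1)² ≤ (d+3)²Mb^{d+1}` for `d ≥ 3`, `Mb ≥ 1`).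
* §4 **`abs_unitK_KTot_ff_le`** (W-fin) — for `3 ≤ d`, `1 ≤ n`, `1 ≤ Mb`, `N = n·Mb`, every `x′ y′ κ l` and any multiplier unit `sm`:
  `|unitK (Mb) sm (KTot N Mb) x′ y′ (inl κ) (inl l)| ≤ CffSup d` — de-periodised by g16 `PeriodisationBound.abs_le_of_periodisations`
  over the cubic coarse tori `(n(k+1))_ν`, `k → ∞`.
* §5 THE ROAD (d = 3, `2 ≤ Lc`): **`abs_unitK_KTot_ff_le_step`** (every `j`, `m`: `N = Lc^(j+m)`, `Mb = Lc^j`, `sf = sfStep Lc j`),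
  **`abs_KPerf_ff_le`** (`m ≥ 1`, by `le_of_tendsto` over gan24 `RealRateKMHolds.tendsto_KTot_KPerf_holds`), **`bdd_blk_KPerf_ff`**
  (`Bdd (blk (KPerf … m) true true) (CffSup 3)` — the `hRb`∕`hslice`-leg currency of `RoadAsympEndLeft`), and
  **`exists_bdd_sliceLegRemainder_left_uniform`** (for an m-BOUNDED comparison sequence `c`: ONE `CR` with
  `Bdd (blk (KPerf m) tt − c m • blk Pker tt) CR` for all `m ≥ 1` — the m-uniform upgrade of g16's per-m
  `SliceLegRemainderBounded.exists_bdd_sliceLegRemainder_left`).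

## HONEST SCOPE
An m- and j-UNIFORM SUP letter for the UNDRESSED perfect ff block in level-j∕perfect units (the LEFT leg of record, R-FP-40 (A));
constant d-only and crude (`γ₀` = b05's kernel (1.90) constant at `a = 1`); the ONLY B5 input anywhere in the chain is the KERNEL
theorem `B5Prop11Lattice.ineq190`.  NOT a decay letter (`hfar`'s pointwise `C_Γ(m)e^{−δt}` stays open), NOT hslice, NOT (ASYMP), NOT D1;
0∕4 row-D1 binders; NOT BetaPertH, NOT continuum, NOT Clay.  HONEST DEPENDENCY: continuum YM on T⁴ ⇐ BetaPertH ∧ nine spine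
estimates (0/9 proved); BetaPertH ⇐ (D1) ∧ (D4) ∧ CAP+tail; G-an2-4 gates asym, D1 and NE2/3/4.
-/

noncomputable section

open scoped BigOperators Matrix ComplexConjugate
open Filter Topology

namespace Summit.QuantumFields.BalabanUV.Beta.FP.PerfectFFBlockBounded

open Matrix
open Literature.MathematicalPhysics.QuantumFieldTheory.Balaban1983to89
open Literature.MathematicalPhysics.QuantumFieldTheory.Balaban1983to89.Beta
open AffineAveraging (Site)
open B12Sec2to5 (l1 l1_nonneg summable_exp_neg_l1)
open ExpKernelCalculus (MKer Decays l1_sub_triangle l1_sub_symm l1_natSmul)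
open B5Prop11Plancherel (Tor fine)
open B5Prop11Lattice (gammaZero gammaZero_pos)
open FluctuationProjection (Cov)
open OneStepResolventKernel (Fib KInv KInv_inl_inl decays_KInv)
open KKTFluctuationKernel (Gam)
open OneStepKernelFamily (LegIdx legPt legW legSet dec sum_legW legW_nonneg legPt_add)
open KernelWard (Bdd)
open Summit.QuantumFields.BalabanUV.Beta.HessKerDressedUnits (unitK unitK_apply legScale legScale_inl)
open Summit.QuantumFields.BalabanUV.Beta.GAN24.TorusAvatar (toTor liftT Periodic toTor_liftT)
open Summit.QuantumFields.BalabanUV.Beta.GAN24.TorusPeriodise (pshift pshift_add pshift_fine pshift_unitVec)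
open Summit.QuantumFields.BalabanUV.Beta.GAN24.CombesThomas (sfStep smStep)
open Summit.QuantumFields.BalabanUV.Beta.GAN24.RealRateKMHolds (tendsto_KTot_KPerf_holds)
open Summit.QuantumFields.BalabanUV.Beta.FP.PerfectObjects (KTot KTot_def)
open Summit.QuantumFields.BalabanUV.Beta.FP.PerfectObjectsT (KPerf)
open Summit.QuantumFields.BalabanUV.Beta.FP.CompositeCovarianceJunction (tsum_Gam_pshift_eq_Cov Cov_apply_im)
open Summit.QuantumFields.BalabanUV.Beta.FP.PeriodisationBound (abs_le_of_periodisations)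
open Summit.QuantumFields.BalabanUV.Beta.FP.PerfectFFBlockTorus (abs_re_doubleSum_Cov_le legPt_inl_eq)
open Summit.QuantumFields.BalabanUV.Beta.D1BFx.PackedKernelSplit (blk blk_tt)
open Summit.QuantumFields.BalabanUV.Beta.FP.PerfectPolarization (Pker)
open Summit.QuantumFields.BalabanUV.Beta.FP.PerfectPropagatorLegData (A0P)
open Summit.QuantumFields.BalabanUV.Beta.FP.PerfectPolarizationWard (bdd_Pker)
open Summit.QuantumFields.BalabanUV.Beta.FP.FineHessianNearLedgerCore (bdd_blk)
open Summit.QuantumFields.BalabanUV.Beta.FP.FineHessianGluonCore (bdd_smul)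
open Summit.QuantumFields.BalabanUV.Beta.FP.SliceLegRemainderBounded (bdd_sub)

/-- [our object] **THE DISPLAYED m-UNIFORM CONSTANT** `CffSup d = γ₀(d+1,1)⁻¹·(d+3)⁵∕8` is used INLINE below as
`(gammaZero (d + 1) 1)⁻¹ * (((d : ℝ) + 3) ^ 5 / 8)`; no definition is introduced. -/
theorem CffSup_nonneg (d : ℕ) : 0 ≤ (gammaZero (d + 1) 1)⁻¹ * (((d : ℝ) + 3) ^ 5 / 8) := by
  have := gammaZero_pos (d + 1) 1
  positivity

/-! ## §1 The ff block of the (j,m)-resolvent as a block-contour double sum; summability -/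

section Unfold

variable {d : ℕ} (N : ℕ) [NeZero N] (Mb : ℕ)

/-- [our object] **the ff block of `unitK sf sm (KTot N Mb)`** = `sf·(Σ_{i,i'} legW·legW·Gam κ p_i l q_{i'})·sf`. -/
theorem unitK_KTot_inl_inl (sf sm : ℝ) (x' y' : Site (d + 1)) (κ l : Fin (d + 1)) :
    unitK sf sm (KTot (d := d) N Mb) x' y' (Sum.inl κ) (Sum.inl l)
      = sf * (∑ i ∈ LegIdx d Mb, ∑ i' ∈ LegIdx d Mb, legW d Mb (Sum.inl κ : Fib d) * legW d Mb (Sum.inl l : Fib d) *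
          Gam (N := N) κ (legPt (d := d) Mb (Sum.inl κ) x' i) l (legPt (d := d) Mb (Sum.inl l) y' i')) * sf := by
  rw [unitK_apply, legScale_inl, legScale_inl, KTot_def]
  rfl

/-- the period lattice dominates the integer lattice in `ℓ¹`: `|t|₁ ≤ |pshift P t|₁` (`P_ν ≥ 1`). [folklore] -/
theorem l1_le_l1_pshift {P : Fin (d + 1) → ℕ} (hP : ∀ ν, 1 ≤ P ν) (t : Site (d + 1)) : l1 t ≤ l1 (pshift P t) := by
  unfold l1
  refine Finset.sum_le_sum fun ν _ => ?_
  simp only [pshift, Int.cast_mul, Int.cast_natCast, abs_mul, Nat.abs_cast]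
  have : (1 : ℝ) ≤ P ν := by exact_mod_cast hP ν
  nlinarith [abs_nonneg ((t ν : ℤ) : ℝ)]

/-- [our object] the fluctuation covariance kernel is summable along any period lattice in its second argument. -/
theorem summable_Gam_pshift {P : Fin (d + 1) → ℕ} (hP : ∀ ν, 1 ≤ P ν) (κ l : Fin (d + 1)) (p q : Site (d + 1)) :
    Summable (fun t : Site (d + 1) => Gam (N := N) κ p l (q + pshift P t)) := by
  obtain ⟨δ, C, hδ, hC, hK⟩ := decays_KInv (N := N) (d := d)
  refine Summable.of_norm_bounded (g := fun t : Site (d + 1) => C * Real.exp (δ * l1 (p - q)) * Real.exp (-δ * l1 t))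
    ((summable_exp_neg_l1 hδ (d + 1)).mul_left _) fun t => ?_
  rw [Real.norm_eq_abs, ← KInv_inl_inl]
  refine (hK p (q + pshift P t) _ _).trans ?_
  have htri : l1 (pshift P t) ≤ l1 (p - (q + pshift P t)) + l1 (p - q) := by
    have h := l1_sub_triangle (q + pshift P t) p q
    rw [show q + pshift P t - q = pshift P t by abel, l1_sub_symm (q + pshift P t) p] at h
    exact h
  have h1 := l1_le_l1_pshift hP t
  rw [mul_assoc, ← Real.exp_add]
  refine mul_le_mul_of_nonneg_left (Real.exp_le_exp.mpr ?_) hC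
  nlinarith

/-- [our object] summability of a field leg of `Gam` in the coarse point: `y′ ↦ Gam κ p l (Mb•y′ + c)` (`Mb ≥ 1`). -/
theorem summable_Gam_leg (hMb : 1 ≤ Mb) (κ l : Fin (d + 1)) (p c : Site (d + 1)) :
    Summable (fun y' : Site (d + 1) => Gam (N := N) κ p l ((Mb : ℤ) • y' + c)) := by
  have h := summable_Gam_pshift N (P := fun _ => Mb) (fun _ => hMb) κ l p c
  have e : (fun y' : Site (d + 1) => Gam (N := N) κ p l ((Mb : ℤ) • y' + c))
      = fun t => Gam (N := N) κ p l (c + pshift (fun _ : Fin (d + 1) => Mb) t) := by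
    funext t
    have ht : (Mb : ℤ) • t + c = c + pshift (fun _ : Fin (d + 1) => Mb) t := by
      rw [add_comm ((Mb : ℤ) • t) c]
      congr 1
    rw [ht]
  rw [e]
  exact h

/-- [our object] the ff block of the (j,m)-resolvent is summable in the coarse point `y′`. -/
theorem summable_unitK_KTot_ff (hMb : 1 ≤ Mb) (sf sm : ℝ) (x' : Site (d + 1)) (κ l : Fin (d + 1)) :
    Summable (fun y' : Site (d + 1) => unitK sf sm (KTot (d := d) N Mb) x' y' (Sum.inl κ) (Sum.inl l)) := by
  simp_rw [unitK_KTot_inl_inl]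
  refine Summable.mul_right _ (Summable.mul_left _ (summable_sum fun i _ => summable_sum fun i' _ => ?_))
  refine Summable.mul_left _ ?_
  simp_rw [legPt_inl_eq Mb l]
  exact summable_Gam_leg N Mb hMb κ l _ _

end Unfold

/-! ## §2 The junction at integer points -/

section Junction

variable {d : ℕ} (N : ℕ) [NeZero N] (hN : 1 ≤ N) (M : Fin (d + 1) → ℕ) [hM : ∀ ν, NeZero (M ν)]

omit hM in
/-- [folklore] the periodised column `y ↦ Σ_t Gam κ p l (y + (NM)•t)` is `(NM)`-periodic (reindexing `t ↦ t + e_ν`). -/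
theorem periodic_tsum_Gam (κ l : Fin (d + 1)) (p : Site (d + 1)) :
    Periodic (fine N M) (fun y => ∑' t : Site (d + 1), Gam (N := N) κ p l (y + pshift (fine N M) t)) := by
  intro y ν
  dsimp only
  have key : ∀ t : Site (d + 1), y + ((fine N M ν : ℕ) : ℤ) • AffineAveraging.unitVec ν + pshift (fine N M) t
      = y + pshift (fine N M) (t + AffineAveraging.unitVec ν) := by
    intro t; rw [pshift_add, pshift_unitVec]; abel
  simp_rw [key]
  exact (Equiv.addRight (AffineAveraging.unitVec ν)).tsum_eq (fun s => Gam (N := N) κ p l (y + pshift (fine N M) s))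

omit hM in
/-- [folklore] the `+`∕`−` forms of the periodisation agree (reindexing `t ↦ −t`). -/
theorem tsum_Gam_pshift_neg (κ l : Fin (d + 1)) (p y : Site (d + 1)) :
    ∑' t : Site (d + 1), Gam (N := N) κ p l (y - pshift (fine N M) t)
      = ∑' t : Site (d + 1), Gam (N := N) κ p l (y + pshift (fine N M) t) := by
  have key : ∀ t : Site (d + 1), y - pshift (fine N M) t = y + pshift (fine N M) (-t) := by
    intro t
    have : pshift (fine N M) (-t) = -pshift (fine N M) t := by funext ν; simp [pshift]
    rw [this, sub_eq_add_neg]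
  simp_rw [key]
  exact (Equiv.neg (Site (d + 1))).tsum_eq (fun s => Gam (N := N) κ p l (y + pshift (fine N M) s))

/-- [our object] **THE ff JUNCTION AT INTEGER POINTS**: for all `p q ∈ ℤ^{d+1}`,
`Σ_t Gam κ p l (q + (NM)•t) = (N²∕2)·Re 𝒞_{(toTor p, κ),(toTor q, l)}` (g15's `tsum_Gam_pshift_eq_Cov` at the canonical lift, moved to `q`
by periodicity; `𝒞` is real). -/
theorem tsum_Gam_pshift_eq_re_Cov (κ l : Fin (d + 1)) (p q : Site (d + 1)) :
    ∑' t : Site (d + 1), Gam (N := N) κ p l (q + pshift (fine N M) t)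
      = ((N : ℝ) ^ 2 / 2) * (Cov N hN M 1 one_pos (toTor (fine N M) p, κ) (toTor (fine N M) q, l)).re := by
  have hper := (periodic_tsum_Gam N M κ l p).apply_liftT_toTor q
  rw [← hper, ← tsum_Gam_pshift_neg]
  have h := tsum_Gam_pshift_eq_Cov N hN M 1 one_pos κ l p (toTor (fine N M) q)
  -- take real parts
  have h' := congrArg Complex.re h
  rw [Complex.ofReal_re] at h'
  rw [h', show ((N : ℂ) ^ 2 / 2) = ((((N : ℝ) ^ 2 / 2 : ℝ)) : ℂ) by push_cast; ring, Complex.re_ofReal_mul]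

end Junction

/-! ## §3 The coarse periodisation of the ff block and its torus bound -/

section Periodised

variable {d : ℕ} (N : ℕ) [NeZero N] (hN : 1 ≤ N) (M : Fin (d + 1) → ℕ) [hM : ∀ ν, NeZero (M ν)] (Mb n : ℕ)

/-- [our object] **THE COARSE PERIODISATION OF THE ff BLOCK** (coarse periods `n·M_ν`, `N = n·Mb`):
`Σ_t unitK Mb sm (KTot N Mb) x′ (y′ + (nM)•t) ff = (Mb²N²∕2)·Σ_{i,i'} legW·legW·Re 𝒞(p̄_i, q̄_{i'})`. -/
theorem tsum_unitK_KTot_ff_pshift_eq (hMbN : N = n * Mb) (sm : ℝ) (x' y' : Site (d + 1)) (κ l : Fin (d + 1)) :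
    ∑' t : Site (d + 1), unitK (Mb : ℝ) sm (KTot (d := d) N Mb) x' (y' + pshift (fine n M) t) (Sum.inl κ) (Sum.inl l)
      = ((Mb : ℝ) ^ 2 * (N : ℝ) ^ 2 / 2) *
        ∑ i ∈ LegIdx d Mb, ∑ i' ∈ LegIdx d Mb, legW d Mb (Sum.inl κ : Fib d) * legW d Mb (Sum.inl l : Fib d) *
          (Cov N hN M 1 one_pos (toTor (fine N M) (legPt (d := d) Mb (Sum.inl κ) x' i), κ)
            (toTor (fine N M) (legPt (d := d) Mb (Sum.inl l) y' i'), l)).re := by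
  have hP : ∀ ν, 1 ≤ fine N M ν := fun ν => Nat.one_le_iff_ne_zero.mpr (NeZero.ne _)
  -- the shifted leg point
  have hleg : ∀ (i' : (Fin (d + 1) → ℕ) × ℕ) (t : Site (d + 1)),
      legPt (d := d) Mb (Sum.inl l) (y' + pshift (fine n M) t) i' = legPt (d := d) Mb (Sum.inl l) y' i' + pshift (fine N M) t := by
    intro i' t
    rw [legPt_add, pshift_fine n M, pshift_fine N M, smul_smul, hMbN]
    push_cast
    ring_nf
  -- pointwise form of the summand
  have hpt : ∀ t : Site (d + 1),
      unitK (Mb : ℝ) sm (KTot (d := d) N Mb) x' (y' + pshift (fine n M) t) (Sum.inl κ) (Sum.inl l)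
        = ((Mb : ℝ) * (Mb : ℝ)) * ∑ i ∈ LegIdx d Mb, ∑ i' ∈ LegIdx d Mb,
            legW d Mb (Sum.inl κ : Fib d) * legW d Mb (Sum.inl l : Fib d) *
            Gam (N := N) κ (legPt (d := d) Mb (Sum.inl κ) x' i) l (legPt (d := d) Mb (Sum.inl l) y' i' + pshift (fine N M) t) := by
    intro t
    rw [unitK_KTot_inl_inl]
    simp_rw [hleg]
    ring
  simp_rw [hpt]
  rw [tsum_mul_left]
  have hsum : ∀ i ∈ LegIdx d Mb, Summable fun t : Site (d + 1) => ∑ i' ∈ LegIdx d Mb,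
      legW d Mb (Sum.inl κ : Fib d) * legW d Mb (Sum.inl l : Fib d) *
        Gam (N := N) κ (legPt (d := d) Mb (Sum.inl κ) x' i) l (legPt (d := d) Mb (Sum.inl l) y' i' + pshift (fine N M) t) :=
    fun i _ => summable_sum fun i' _ => (summable_Gam_pshift N hP κ l _ _).mul_left _
  rw [Summable.tsum_finsetSum hsum]
  have inner : ∀ i ∈ LegIdx d Mb,
      ∑' t : Site (d + 1), ∑ i' ∈ LegIdx d Mb, legW d Mb (Sum.inl κ : Fib d) * legW d Mb (Sum.inl l : Fib d) *
          Gam (N := N) κ (legPt (d := d) Mb (Sum.inl κ) x' i) l (legPt (d := d) Mb (Sum.inl l) y' i' + pshift (fine N M) t)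
        = ∑ i' ∈ LegIdx d Mb, legW d Mb (Sum.inl κ : Fib d) * legW d Mb (Sum.inl l : Fib d) *
          (((N : ℝ) ^ 2 / 2) * (Cov N hN M 1 one_pos (toTor (fine N M) (legPt (d := d) Mb (Sum.inl κ) x' i), κ)
            (toTor (fine N M) (legPt (d := d) Mb (Sum.inl l) y' i'), l)).re) := by
    intro i _
    rw [Summable.tsum_finsetSum (fun i' _ => (summable_Gam_pshift N hP κ l _ _).mul_left _)]
    refine Finset.sum_congr rfl fun i' _ => ?_
    rw [tsum_mul_left, tsum_Gam_pshift_eq_re_Cov N hN M]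
  rw [Finset.sum_congr rfl inner, Finset.mul_sum, Finset.mul_sum]
  refine Finset.sum_congr rfl fun i _ => ?_
  rw [Finset.mul_sum, Finset.mul_sum]
  refine Finset.sum_congr rfl fun i' _ => ?_
  ring

include hN in
/-- [our object] **THE TORUS BOUND ON THE PERIODISED ff BLOCK**: `≤ CffSup d` on every large torus (`3 ≤ d`, `1 ≤ Mb`). -/
theorem abs_tsum_unitK_KTot_ff_pshift_le (hd : 3 ≤ d) (hMb : 1 ≤ Mb) (hMbN : N = n * Mb)
    (hPt : ∀ ν, 16 * ((d + 1 : ℕ) : ℝ) * (N : ℝ) ^ 2 + 10 ≤ ((N * M ν : ℕ) : ℝ))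
    (hPR : ∀ ν, 2 * (2 * (Mb : ℝ) + ((d + 1 : ℕ) : ℝ)) + 2 < ((N * M ν : ℕ) : ℝ))
    (hP4 : ∀ ν, 4 * Mb ≤ N * M ν)
    (sm : ℝ) (x' y' : Site (d + 1)) (κ l : Fin (d + 1)) :
    |∑' t : Site (d + 1), unitK (Mb : ℝ) sm (KTot (d := d) N Mb) x' (y' + pshift (fine n M) t) (Sum.inl κ) (Sum.inl l)|
      ≤ (gammaZero (d + 1) 1)⁻¹ * (((d : ℝ) + 3) ^ 5 / 8) := by
  rw [tsum_unitK_KTot_ff_pshift_eq N hN M Mb n hMbN, abs_mul, abs_of_nonneg (by positivity)]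
  have h := abs_re_doubleSum_Cov_le N hN M Mb hd hMb hPt hPR hP4 x' y' κ l
  have hγ : 0 < (gammaZero (d + 1) 1)⁻¹ := inv_pos.mpr (gammaZero_pos (d + 1) 1)
  have hMb1 : (1 : ℝ) ≤ Mb := by exact_mod_cast hMb
  have hN0 : (0 : ℝ) < N := by
    have : 1 ≤ N := hN
    exact_mod_cast Nat.lt_of_lt_of_le Nat.zero_lt_one this
  have hd3 : (3 : ℝ) ≤ d := by exact_mod_cast hd
  -- the arithmetic `(Mb²N²/2)·γ⁻¹·(Mb^{d+1})⁻¹·(d+3)³R²/(4N²) ≤ γ⁻¹(d+3)⁵/8`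
  calc (Mb : ℝ) ^ 2 * (N : ℝ) ^ 2 / 2 * |∑ i ∈ LegIdx d Mb, ∑ i' ∈ LegIdx d Mb,
          legW d Mb (Sum.inl κ : Fib d) * legW d Mb (Sum.inl l : Fib d) *
          (Cov N hN M 1 one_pos (toTor (fine N M) (legPt (d := d) Mb (Sum.inl κ) x' i), κ)
            (toTor (fine N M) (legPt (d := d) Mb (Sum.inl l) y' i'), l)).re|
      ≤ (Mb : ℝ) ^ 2 * (N : ℝ) ^ 2 / 2 * ((gammaZero (d + 1) 1)⁻¹ *
          (1 * ((((Mb : ℝ) ^ (d + 1))⁻¹) * ((((d + 1 : ℕ) : ℝ) + 2) ^ 3 * (2 * (Mb : ℝ) + ((d + 1 : ℕ) : ℝ)) ^ 2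
            / (4 * (N : ℝ) ^ 2))))) := mul_le_mul_of_nonneg_left h (by positivity)
    _ = (gammaZero (d + 1) 1)⁻¹ * ((((d : ℝ) + 3) ^ 3 * ((Mb : ℝ) ^ 2 * (2 * (Mb : ℝ) + ((d : ℝ) + 1)) ^ 2
          * ((Mb : ℝ) ^ (d + 1))⁻¹)) / 8) := by
        push_cast
        field_simp
        ring
    _ ≤ (gammaZero (d + 1) 1)⁻¹ * (((d : ℝ) + 3) ^ 5 / 8) := by
        refine mul_le_mul_of_nonneg_left ?_ hγ.le
        rw [div_le_div_iff_of_pos_right (by norm_num : (0 : ℝ) < 8),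
          show ((d : ℝ) + 3) ^ 5 = ((d : ℝ) + 3) ^ 3 * ((d : ℝ) + 3) ^ 2 by ring]
        refine mul_le_mul_of_nonneg_left ?_ (by positivity)
        -- `Mb² (2Mb + d + 1)² ≤ (d+3)² Mb^{d+1}`
        have hR : 2 * (Mb : ℝ) + ((d : ℝ) + 1) ≤ ((d : ℝ) + 3) * Mb := by nlinarith
        have hpow : (Mb : ℝ) ^ 4 ≤ (Mb : ℝ) ^ (d + 1) := pow_le_pow_right₀ hMb1 (by omega)
        have hMbpos : (0 : ℝ) < (Mb : ℝ) ^ (d + 1) := by positivity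
        rw [mul_inv_le_iff₀ hMbpos]
        calc (Mb : ℝ) ^ 2 * (2 * (Mb : ℝ) + ((d : ℝ) + 1)) ^ 2 ≤ (Mb : ℝ) ^ 2 * (((d : ℝ) + 3) * Mb) ^ 2 := by
              refine mul_le_mul_of_nonneg_left ?_ (by positivity)
              exact pow_le_pow_left₀ (by positivity) hR 2
          _ = ((d : ℝ) + 3) ^ 2 * (Mb : ℝ) ^ 4 := by ring
          _ ≤ ((d : ℝ) + 3) ^ 2 * (Mb : ℝ) ^ (d + 1) := mul_le_mul_of_nonneg_left hpow (by positivity)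

end Periodised

/-! ## §4 De-periodisation: the sup letter at every finite `(N, Mb)` -/

section Sup

variable {d : ℕ}

/-- [our object] **(W-fin) THE ff BLOCK OF THE UNIT-RESCALED (j,m)-RESOLVENT IS BOUNDED, UNIFORMLY**: for `3 ≤ d`, `1 ≤ n`, `1 ≤ Mb`,
`N = n·Mb`, every `x′ y′ κ l` and any multiplier unit `sm`, `|unitK Mb sm (KTot N Mb) x′ y′ (inl κ) (inl l)| ≤ γ₀(d+1,1)⁻¹(d+3)⁵∕8`. -/
theorem abs_unitK_KTot_ff_le (hd : 3 ≤ d) {N n Mb : ℕ} [NeZero N] (hn : 1 ≤ n) (hMb : 1 ≤ Mb) (hMbN : N = n * Mb)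
    (sm : ℝ) (x' y' : Site (d + 1)) (κ l : Fin (d + 1)) :
    |unitK (Mb : ℝ) sm (KTot (d := d) N Mb) x' y' (Sum.inl κ) (Sum.inl l)|
      ≤ (gammaZero (d + 1) 1)⁻¹ * (((d : ℝ) + 3) ^ 5 / 8) := by
  have hN : 1 ≤ N := by rw [hMbN]; exact Nat.one_le_iff_ne_zero.mpr (Nat.mul_ne_zero (by omega) (by omega))
  -- cubic coarse tori `(k+1, …)` and the coarse period lattices `(n(k+1))_ν`
  let P : ℕ → Fin (d + 1) → ℕ := fun k => fine n (fun _ : Fin (d + 1) => k + 1)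
  have hP1 : ∀ k ν, 1 ≤ P k ν := fun k ν => by
    show 1 ≤ n * (k + 1)
    exact Nat.one_le_iff_ne_zero.mpr (Nat.mul_ne_zero (by omega) (Nat.succ_ne_zero k))
  have hPgrow : ∀ R : ℕ, ∀ᶠ k in atTop, ∀ ν, R ≤ P k ν := fun R => by
    refine (eventually_ge_atTop R).mono fun k hk ν => ?_
    show R ≤ n * (k + 1)
    calc R ≤ k + 1 := hk.trans (Nat.le_succ k)
      _ ≤ n * (k + 1) := Nat.le_mul_of_pos_left _ hn
  -- the torus bound holds for all large `k`
  have hB : ∀ᶠ k in atTop,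
      |∑' t : Site (d + 1), unitK (Mb : ℝ) sm (KTot (d := d) N Mb) x' (y' + pshift (P k) t) (Sum.inl κ) (Sum.inl l)|
        ≤ (gammaZero (d + 1) 1)⁻¹ * (((d : ℝ) + 3) ^ 5 / 8) := by
    refine (eventually_ge_atTop (16 * (d + 1) * N ^ 2 + 4 * Mb + 2 * d + 20)).mono fun k hk => ?_
    have hk' : (16 * (d + 1) * N ^ 2 + 4 * Mb + 2 * d + 20 : ℕ) ≤ N * (k + 1) :=
      hk.trans ((Nat.le_succ k).trans (Nat.le_mul_of_pos_left _ hN))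
    have hkR : ((16 * (d + 1) * N ^ 2 + 4 * Mb + 2 * d + 20 : ℕ) : ℝ) ≤ ((N * (k + 1) : ℕ) : ℝ) := by exact_mod_cast hk'
    push_cast at hkR
    refine abs_tsum_unitK_KTot_ff_pshift_le N hN (fun _ : Fin (d + 1) => k + 1) Mb n hd hMb hMbN ?_ ?_ ?_ sm x' y' κ l
    · intro ν; push_cast; nlinarith
    · intro ν; push_cast; nlinarith
    · intro ν; omega
  exact abs_le_of_periodisations (summable_unitK_KTot_ff N Mb hMb (Mb : ℝ) sm x' κ l) y' hP1 hPgrow hB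

end Sup

/-! ## §5 The road (d = 3): every finite (j, m), the perfect resolvent, and the `hRb` currency -/

section Road

variable {Lc : ℕ} [NeZero Lc]

/-- [our object] **(W-jm)** for every `j`, `m` (`2 ≤ Lc`): `|unitK (sfStep Lc j) (smStep 3 Lc j) (KTot (Lc^(j+m)) (Lc^j)) ff| ≤ γ₀(4,1)⁻¹·6⁵∕8`. -/
theorem abs_unitK_KTot_ff_le_step (hLc : 2 ≤ Lc) (m j : ℕ) (x' y' : Site (3 + 1)) (κ l : Fin (3 + 1)) :
    |unitK (sfStep Lc j) (smStep 3 Lc j) (KTot (d := 3) (Lc ^ (j + m)) (Lc ^ j)) x' y' (Sum.inl κ) (Sum.inl l)|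
      ≤ (gammaZero (3 + 1) 1)⁻¹ * ((((3 : ℕ) : ℝ) + 3) ^ 5 / 8) := by
  have hsf : sfStep Lc j = ((Lc ^ j : ℕ) : ℝ) := by simp [sfStep]
  rw [hsf]
  have hLc1 : 1 ≤ Lc := by omega
  exact abs_unitK_KTot_ff_le (d := 3) le_rfl (n := Lc ^ m) (Nat.one_le_pow _ _ hLc1) (Nat.one_le_pow _ _ hLc1)
    (by rw [pow_add, mul_comm]) _ x' y' κ l

/-- [our object] **(W) THE PERFECT ff BLOCK IS BOUNDED UNIFORMLY IN `m`** (`2 ≤ Lc`, `1 ≤ m`):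
`|KPerf Lc (sfStep Lc) (smStep 3 Lc) m x′ y′ (inl κ) (inl l)| ≤ γ₀(4,1)⁻¹·6⁵∕8`. -/
theorem abs_KPerf_ff_le (hLc : 2 ≤ Lc) {m : ℕ} (hm : 1 ≤ m) (x' y' : Site (3 + 1)) (κ l : Fin (3 + 1)) :
    |KPerf (d := 3) Lc (sfStep Lc) (smStep 3 Lc) m x' y' (Sum.inl κ) (Sum.inl l)|
      ≤ (gammaZero (3 + 1) 1)⁻¹ * ((((3 : ℕ) : ℝ) + 3) ^ 5 / 8) := by
  have ht := (tendsto_KTot_KPerf_holds hLc hm x' y' (Sum.inl κ) (Sum.inl l)).abs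
  exact le_of_tendsto' ht fun j => abs_unitK_KTot_ff_le_step hLc m j x' y' κ l

/-- [our object] **(W-hRb) the `hRb`∕`hslice`-leg currency**: `Bdd (blk (KPerf … m) true true) (γ₀(4,1)⁻¹·6⁵∕8)` for every `m ≥ 1`. -/
theorem bdd_blk_KPerf_ff (hLc : 2 ≤ Lc) {m : ℕ} (hm : 1 ≤ m) :
    Bdd (blk (KPerf (d := 3) Lc (sfStep Lc) (smStep 3 Lc) m) true true)
      ((gammaZero (3 + 1) 1)⁻¹ * ((((3 : ℕ) : ℝ) + 3) ^ 5 / 8)) := by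
  intro x y a b
  rw [blk_tt]
  exact abs_KPerf_ff_le hLc hm x y a b

/-- [our object] **THE m-UNIFORM SLICE-LEG REMAINDER** (upgrade of g16's per-m `exists_bdd_sliceLegRemainder_left`): for any comparison
sequence `c` with `|c m| ≤ cmax`, ONE constant `CR = γ₀(4,1)⁻¹·6⁵∕8 + cmax·A0P` bounds `blk (KPerf m) tt − c m • blk Pker tt` for all `m ≥ 1`. -/
theorem exists_bdd_sliceLegRemainder_left_uniform (hLc : 2 ≤ Lc) (c : ℕ → ℝ) {cmax : ℝ} (hc : ∀ m, |c m| ≤ cmax) :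
    ∃ CR : ℝ, ∀ m : ℕ, 1 ≤ m →
      Bdd (blk (KPerf (d := 3) Lc (sfStep Lc) (smStep 3 Lc) m) true true - c m • blk Pker true true) CR := by
  refine ⟨(gammaZero (3 + 1) 1)⁻¹ * ((((3 : ℕ) : ℝ) + 3) ^ 5 / 8) + cmax * A0P, fun m hm => ?_⟩
  have h := bdd_sub (bdd_blk_KPerf_ff hLc hm) (bdd_smul (bdd_blk bdd_Pker true true) (c m))
  intro x y a b
  refine (h x y a b).trans ?_
  have hA : 0 ≤ A0P := by
    have := bdd_Pker (0 : Site (3 + 1)) 0 (Sum.inl 0) (Sum.inl 0)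
    exact (abs_nonneg _).trans this
  nlinarith [hc m, abs_nonneg (c m)]

end Road

end Summit.QuantumFields.BalabanUV.Beta.FP.PerfectFFBlockBounded
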